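import Summits.KontsevichZagierPeriods.KontsevichZagierPeriods.Theses.FurushoPentagon
import Literature.NumberTheory.Transcendental.KZRulesAssociator
import Literature.NumberTheory.Transcendental.KZLogCalculusProofs

/-!
# `ReducedPeriodRing` (stmt-KontsevichZagierPeriods-3929) — dimension 0 carries no nilpotent

The smallest sub-calculus: the subgroup generated by the 0-dimensional representations `[τ, a]`
(`τ ∈ {∅, pt}`, `a` real algebraic — the constants of the calculus) satisfies the kernel
conjecture (`dimZero_kernel`): modulo relations every element is ONE constant `[pt, a]` with
`a = eval c`, and `[pt, 0] ∈ relations`. Hence no nilpotent of the formal period ring lives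
among the constants (`reducedPeriodRing_dimZero`); e.g. `[pt, √2]² = [pt, 2]` behaves.
cdisprove (refuter) boundary lemma; companions `Negative/PositiveCone.lean`, `Negative/RingForms.lean`.
[Kontsevich–Zagier 2001, §1.1 (ℝ⁰ is a point of volume 1), §1.2 rule (1)]
-/

noncomputable section

namespace Summit.KontsevichZagierPeriods.KontsevichZagierPeriods.ReducedPeriodRingNegative

open Literature.NumberTheory.Transcendental KZ
open Summit.KontsevichZagierPeriods.KontsevichZagierPeriods.Theses.FurushoPentagon
open MeasureTheory Set
open Literature.ModelTheory.ExponentialFields (IsSemialgebraic isSemialgebraic_univ)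

/-! The constants of the calculus — the subgroup generated by the 0-dimensional representations —
is written out below as `AddSubgroup.closure (Set.range fun r : IntegralRep 0 => of r)` (the
`def dimZero` of the cdisprove work file). -/

/-- In dimension `0` the value is the value of the integrand at the point. [KZ 2001, §1.1] -/
theorem value_eq_integrand_default (r : IntegralRep 0) (h : r.domain = univ) :
    r.value = r.integrand default := by
  have hconst : r.integrand = fun _ => r.integrand default :=
    funext fun x => congrArg r.integrand (Subsingleton.elim x default)
  rw [IntegralRep.value, h, hconst, setIntegral_const]
  simp [measureReal_def, volume_univ_fin_zero]

/-- Every constant combination is ONE constant modulo relations. [folklore] -/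
theorem exists_of_sub_mem_relations_of_mem_dimZero {c : FormalRep}
    (hc : c ∈ AddSubgroup.closure (Set.range fun r : IntegralRep 0 => of r)) :
    ∃ R : IntegralRep 0, R.domain = univ ∧ c - of R ∈ relations := by
  induction hc using AddSubgroup.closure_induction with
  | mem x hx =>
    obtain ⟨r, rfl⟩ := hx
    rcases Set.eq_empty_or_nonempty r.domain with h | h
    · obtain ⟨z, hzd, hzi⟩ := exists_zeroRep (n := 0) (isSemialgebraic_univ (k := ℚ))
      refine ⟨z, hzd, ?_⟩
      have h1 : of r ∈ relations := of_mem_relations_of_volume_eq_zero r (by rw [h]; simp)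
      exact relations.sub_mem h1 (of_mem_relations_of_eqOn_zero z (by simp [hzi, EqOn]))
    · exact ⟨r, Subsingleton.eq_univ_of_nonempty h, by simp [relations.zero_mem]⟩
  | zero =>
    obtain ⟨z, hzd, hzi⟩ := exists_zeroRep (n := 0) (isSemialgebraic_univ (k := ℚ))
    refine ⟨z, hzd, ?_⟩
    simpa using relations.neg_mem (of_mem_relations_of_eqOn_zero z (by simp [hzi, EqOn]))
  | add x y hx hy ihx ihy =>
    obtain ⟨R₁, h₁, hx₁⟩ := ihx
    obtain ⟨R₂, h₂, hy₂⟩ := ihy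
    -- the sum representation `[pt, f₁ + f₂]`
    let R : IntegralRep 0 :=
      { domain := univ
        integrand := R₁.integrand + R₂.integrand
        isSemialgebraic_domain := isSemialgebraic_univ
        isSemialgebraicFunOn_integrand :=
          IsSemialgebraicFunOn.add_holds (h₁ ▸ R₁.isSemialgebraicFunOn_integrand)
            (h₂ ▸ R₂.isSemialgebraicFunOn_integrand)
        integrableOn := (h₁ ▸ R₁.integrableOn).add (h₂ ▸ R₂.integrableOn) }
    refine ⟨R, rfl, ?_⟩
    have hmem : of R - of R₁ - of R₂ ∈ integrandAddRel :=
      ⟨0, R, R₁, R₂, h₁, h₂, fun _ _ => rfl, rfl⟩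
    have h3 := integrandAddRel_subset_relations hmem
    have heq : x + y - of R = (x - of R₁) + (y - of R₂) - (of R - of R₁ - of R₂) := by abel
    rw [heq]
    exact relations.sub_mem (relations.add_mem hx₁ hy₂) h3
  | neg x hx ih =>
    obtain ⟨R, hR, hxR⟩ := ih
    refine ⟨R.neg, hR, ?_⟩
    have heq : -x - of R.neg = -(x - of R) - (of R + of R.neg) := by abel
    rw [heq]
    exact relations.sub_mem (relations.neg_mem hxR)
      (of_add_of_mem_relations_of_eqOn_neg (r := R) (r' := R.neg) rfl (fun _ _ => rfl))

/-- **The kernel conjecture holds on the constants.** [folklore] -/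
theorem dimZero_kernel {c : FormalRep}
    (hc : c ∈ AddSubgroup.closure (Set.range fun r : IntegralRep 0 => of r)) (h0 : eval c = 0) :
    c ∈ relations := by
  obtain ⟨R, hR, hcR⟩ := exists_of_sub_mem_relations_of_mem_dimZero hc
  have hv : R.value = 0 := by
    have h1 : eval (c - of R) = 0 := relations_le_ker_eval_holds hcR
    rw [map_sub, h0, eval_of, zero_sub, neg_eq_zero] at h1
    exact h1
  have hint : R.integrand default = 0 := by rwa [value_eq_integrand_default R hR] at hv
  have hRrel : of R ∈ relations :=
    of_mem_relations_of_eqOn_zero R (fun x _ => by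
      rw [Subsingleton.elim x default, hint]; rfl)
  have := relations.add_mem hcR hRrel
  simpa using this

/-- **No nilpotent among the constants.** [folklore] -/
theorem reducedPeriodRing_dimZero {c : FormalRep}
    (hc : c ∈ AddSubgroup.closure (Set.range fun r : IntegralRep 0 => of r)) (h : c * c ∈ relations) :
    c ∈ relations := by
  refine dimZero_kernel hc ?_
  have h0 : eval (c * c) = 0 := relations_le_ker_eval_holds h
  rw [eval_mul'] at h0
  exact mul_self_eq_zero.mp h0

end Summit.KontsevichZagierPeriods.KontsevichZagierPeriods.ReducedPeriodRingNegative
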